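import Summits.Ventures.DiscreteObjects.Hadamard.ElemAbelian23Tools
import Summits.Ventures.DiscreteObjects.Hadamard.HadamardOrbitCounts668

/-!
# Hadamard 668 census, family F12 — `C_p × C_p`: general-`p` tools (transitivity of a fixed-point-free `p`-cycle on an
# invariant `p`-set, fixed points in an invariant set mod `p`) and the order-11 census (kernel)

Framing: lottery ticket; floor = certified bounds/negative ranges.

Cell pub-namedobj (venture DiscreteObjects), target (H), hadamard gen 16.  General-`p` versions of the `ElemAbelian23Tools`
lemmas (`exists_pow_apply_eq_prime`, `card_filter_fixed_mod_prime`, `pm_pow_11`) and the census for order 11 at the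
matrix level: a signed automorphism `(π, κ, d, e)` of an H(668) with `π¹¹ = κ¹¹ = 1`, `π ≠ 1`, fixes `8`, `30` or `52`
columns and `8`, `30` or `52` rows (`census11`; from the windows `hadamard668_signedAut_colClasses_window` /
`rowClasses_window`: `56 ≤ m ≤ 60` classes, `m` even, `#Fix + 11 m = 668`).  Used by `ElemAbelianRank2_11`.  Ours; no
`sorry`.
-/

namespace Summit.Ventures.DiscreteObjects.Hadamard

open Finset BigOperators

open Literature.Combinatorics.Designs.GoethalsSeidel (IsHadamardMatrix)

variable {ι : Type*} [Fintype ι] [DecidableEq ι]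

omit [Fintype ι] [DecidableEq ι] in
/-- `x^11 = x` for `x = ±1` -/
lemma pm_pow_11 {x : ℤ} (hx : x = 1 ∨ x = -1) : x ^ 11 = x := by
  rcases hx with rfl | rfl <;> norm_num

omit [Fintype ι] in
/-- **a fixed-point-free permutation of prime exponent `p` on an invariant `p`-set is transitive there** -/
lemma exists_pow_apply_eq_prime (p : ℕ) [hp : Fact p.Prime] (σ : Equiv.Perm ι) (hσ : σ ^ p = 1) (B : Finset ι)
    (hB : B.card = p) (hinv : ∀ x ∈ B, σ x ∈ B) (hfpf : ∀ x ∈ B, σ x ≠ x) {x₀ : ι} (hx₀ : x₀ ∈ B) {x : ι}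
    (hx : x ∈ B) : ∃ k : ℕ, (σ ^ k) x₀ = x := by
  have hmem : ∀ k : ℕ, (σ ^ k) x₀ ∈ B := by
    intro k; induction k with
    | zero => simpa using hx₀
    | succ k ih => rw [pow_succ', Equiv.Perm.mul_apply]; exact hinv _ ih
  set S := (Finset.range p).image (fun k => (σ ^ k) x₀) with hS
  have hSB : S ⊆ B := by
    intro y hy; rw [hS, Finset.mem_image] at hy; obtain ⟨k, -, rfl⟩ := hy; exact hmem k
  have hScard : S.card = p := by
    rw [hS, Finset.card_image_of_injOn, Finset.card_range]
    intro k hk l hl hkl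
    simp only [Finset.coe_range, Set.mem_Iio] at hk hl
    simp only at hkl
    by_contra hne
    rcases Nat.lt_or_gt_of_ne hne with hlt | hlt
    · have e : (σ ^ (l - k)) ((σ ^ k) x₀) = (σ ^ k) x₀ := by
        rw [← Equiv.Perm.mul_apply, ← pow_add, show l - k + k = l by omega, ← hkl]
      exact hfpf _ (hmem k) (fixed_of_pow_fixed p σ hσ (by omega) (by omega) e)
    · have e : (σ ^ (k - l)) ((σ ^ l) x₀) = (σ ^ l) x₀ := by
        rw [← Equiv.Perm.mul_apply, ← pow_add, show k - l + l = k by omega, hkl]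
      exact hfpf _ (hmem l) (fixed_of_pow_fixed p σ hσ (by omega) (by omega) e)
  have hSeq : S = B := Finset.eq_of_subset_of_card_le hSB (by rw [hB, hScard])
  rw [← hSeq, hS, Finset.mem_image] at hx
  obtain ⟨k, -, hk⟩ := hx
  exact ⟨k, hk⟩

omit [Fintype ι] in
/-- **fixed points inside an invariant set, mod `p`**: for `τ^p = 1` and a `τ`-invariant finite set `F`,
`#{x ∈ F : τ x = x} ≡ |F| (mod p)`. -/
lemma card_filter_fixed_mod_prime (p : ℕ) (hp : p.Prime) (τ : Equiv.Perm ι) (hτ : τ ^ p = 1) (F : Finset ι)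
    (hF : ∀ x, x ∈ F ↔ τ x ∈ F) :
    (F.filter fun x => τ x = x).card % p = F.card % p := by
  have hF' : ∀ x, τ x ∈ F ↔ x ∈ F := fun x => (hF x).symm
  set ρ : Equiv.Perm {x // x ∈ F} := τ.subtypePerm hF' with hρ
  have hρp : ρ ^ p = 1 := by
    ext ⟨x, hx⟩
    have h1 : (((ρ ^ p) ⟨x, hx⟩ : {x // x ∈ F}) : ι) = (τ ^ p) x := by
      rw [hρ, Equiv.Perm.subtypePerm_pow]; rfl
    rw [h1, hτ]; rfl
  have h := card_fixed_mod ρ hp hρp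
  rw [Fintype.card_coe] at h
  rw [← h]
  congr 1
  refine Finset.card_bij' (fun x hx => ⟨x, (Finset.mem_filter.mp hx).1⟩) (fun x _ => x.1) ?_ ?_ ?_ ?_
  · intro x hx
    rw [Finset.mem_filter] at hx ⊢
    refine ⟨Finset.mem_univ _, ?_⟩
    rw [hρ]; exact Subtype.ext (by rw [Equiv.Perm.subtypePerm_apply]; exact hx.2)
  · intro x hx
    rw [Finset.mem_filter] at hx ⊢
    refine ⟨x.2, ?_⟩
    have := congrArg Subtype.val hx.2
    rw [hρ, Equiv.Perm.subtypePerm_apply] at this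
    exact this
  · intro x hx; rfl
  · intro x hx; rfl

/-- the census for order 11 at the matrix level: `8`, `30` or `52` fixed columns and `8`, `30` or `52` fixed rows -/
lemma census11 {H : Matrix ι ι ℤ} (hH : IsHadamardMatrix H) (hι : Fintype.card ι = 668)
    {π κ : Equiv.Perm ι} {d e : ι → ℤ} (haut : IsSignedAut H π κ d e) (hπ : π ^ 11 = 1) (hκ : κ ^ 11 = 1)
    (hne : π ≠ 1) :
    ((univ.filter fun j => κ j = j).card = 8 ∨ (univ.filter fun j => κ j = j).card = 30 ∨
      (univ.filter fun j => κ j = j).card = 52) ∧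
    ((univ.filter fun i => π i = i).card = 8 ∨ (univ.filter fun i => π i = i).card = 30 ∨
      (univ.filter fun i => π i = i).card = 52) := by
  have hp : (11 : ℕ).Prime := by norm_num
  have hmem : (11 : ℕ) = 3 ∨ (11 : ℕ) = 5 ∨ (11 : ℕ) = 7 ∨ (11 : ℕ) = 11 := Or.inr (Or.inr (Or.inr rfl))
  obtain ⟨⟨a, ha⟩, -, -, -, wc⟩ := hadamard668_signedAut_colClasses_window hH hι hmem π κ d e haut hπ hκ (Or.inl hne)
  obtain ⟨⟨b, hb⟩, -, -, -, wr⟩ := hadamard668_signedAut_rowClasses_window hH hι hmem π κ d e haut hπ hκ (Or.inl hne)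
  have hc1 := card_fixed_add_classes κ hp hκ
  have hr1 := card_fixed_add_classes π hp hπ
  rw [hι] at hc1 hr1
  have wc' := wc rfl
  have wr' := wr rfl
  constructor <;> omega

set_option maxHeartbeats 2000000 in
/-- the final linear system of the `C₁₁ × C₁₁` argument (`ElemAbelianRank2_11`) has no solution: `Tc = |T|`,
`dD = |D|`, `S₁, S₂` the sums of `f(r) − |D|` over all / all but one representative, `W = Σ_r f(r)`, `fK = f(r_K)` -/
lemma rank2_11_arith (Tc dD S₁ S₂ W fK : ℕ) (h1 : 11 * Tc ≤ 668) (h2 : Tc = dD + S₂)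
    (h3 : S₁ = S₂ + (fK - dD)) (h4 : dD ≤ fK) (h5 : fK = 8 ∨ fK = 30 ∨ fK = 52) (h6 : S₁ + 12 * dD = W)
    (h7 : 121 ∣ 668 + 10 * W) (h8 : 2 ∣ W) (h9 : W ≤ 624) (h10 : fK % 11 = dD % 11)
    (h11 : dD % 22 ≠ 8 → 132 ≤ S₁) : False := by
  obtain ⟨c, hc⟩ := h7
  obtain ⟨w, hw⟩ := h8
  have hd8 : dD % 11 = 8 := by rcases h5 with h0 | h0 | h0 <;> rw [h0] at h10 <;> omega
  have hd : dD = 8 ∨ dD = 19 ∨ dD = 30 ∨ dD = 41 ∨ dD = 52 := by omega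
  clear h10
  rcases hd with rfl | rfl | rfl | rfl | rfl
  · rcases h5 with rfl | rfl | rfl <;> omega
  · have := h11 (by norm_num)
    omega
  · rcases h5 with rfl | rfl | rfl <;> omega
  · have := h11 (by norm_num)
    omega
  · omega


end Summit.Ventures.DiscreteObjects.Hadamard
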